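import Mathlib.Analysis.SpecialFunctions.Trigonometric.Basic
import Mathlib.LinearAlgebra.Matrix.Notation
import Mathlib.LinearAlgebra.Matrix.Determinant.Basic
import Mathlib.Tactic
import Literature.MathematicalPhysics.QuantumLattice.TightBindingFitOrthogonality
import Literature.Probability.LatticeModels.TorusFourierMomentBound

/-!
# The Zhang–Rice plaquette orbitals of the three-band model: the bonding/non-bonding oxygen rotation
# at fixed momentum, the `d`-coupling form factor `u_k = 2√(cos²(k_x/2) + cos²(k_y/2))`, its square as
# a nearest-neighbour trigonometric polynomial, the second-order scales `t_P, J_P, E_ZR`, and the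
# fourth-order superexchange in its primary normalisation

The cell-perturbation ("technique A") route from the three-band (Emery) model to a one-band model
starts by rotating, at each momentum `k`, the two oxygen `σ` orbitals `p_{x,k}, p_{y,k}` into the
combination that couples to the copper `d_{x²−y²}` and the one that does not [XiangWu2022, §2.4
Eqs. (2.13)–(2.16)]: with `c_x = cos(k_x/2)`, `c_y = cos(k_y/2)`,
`a_k = (c_x p_{x,k} + c_y p_{y,k})/√(c_x² + c_y²)`, `b_k = (c_y p_{x,k} − c_x p_{y,k})/√(c_x² + c_y²)`,
`H₁ = −t_pd Σ_{ij} u(i−j)(a†_j d_i + h.c.)`, `u(r) = (2/N) Σ_k √(c_x² + c_y²) e^{ik·r}`, and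
«`Σ_i u(i−j)u(i−j′) = 4δ_{j,j′} + δ_{⟨j,j′⟩}`» (2.17); «there is no interaction between `b` and `d`
electrons. Thus `b_i` is a nonbonding orbital» (p. 64).  Second order in `t_pd` gives `t_P = t_pd²/Δ`,
`J_P = t_pd²/Δ + t_pd²/(U_d − Δ)` (2.21)–(2.22), the Zhang–Rice singlet–triplet splitting
`E_ZR = 2J_P u(0)²` (2.29) with the printed `u(0,0) = 1.91618` (= twice Zhang–Rice's `0.958`), and the
one-band hopping `t = t_P/2` (2.34).

This file types the EXACT part of that chain; the perturbative coefficients are DEFINITIONS carrying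
their printed form, and one printed coefficient is recorded TOGETHER WITH its primary normalisation:

* §1 at fixed `k` with `c_x² + c_y² ≠ 0`: the plaquette rotation `R = (1/√(c_x²+c_y²))[[c_x, c_y],
  [c_y, −c_x]]` is orthogonal and symmetric (`Rᵀ R = 1`, `R² = 1`, `det R = −1`): `(a_k, b_k)` are
  canonical fermions.
* §2 the `d`–`p` hybridisation row of the three-band model in this gauge, `(2c_x, 2c_y)·(−t_pd)`, is
  mapped by `R` to `(−t_pd·u_k, 0)` with `u_k = 2√(c_x² + c_y²)`: `d` couples to `a` only, `b`
  DECOUPLES exactly (the two-band reduction at `U_p = 0`).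
* §3 `u_k² = 4(c_x² + c_y²) = 4 + 2cos k_x + 2cos k_y` (half-angle identity): the Fourier side of
  (2.17) — `u²` is the nearest-neighbour trigonometric polynomial with coefficient `4` at `R = 0` and
  `1` on each of the four bonds; `0 ≤ u_k² ≤ 8`, `= 8` at `Γ`, `= 0` only where `cos k_x = cos k_y =
  −1`. (The real-space convolution statement is §6.)
* §4 `t_P`, `J_P`, `E_ZR`, `t = t_P/2` as printed, with the exact relations `J_P = t_P·U_d/(U_d − Δ)`,
  `J_P > t_P > 0` for `U_d > Δ > 0`, `E_ZR = 2u(0)² J_P` and, at the printed `u(0) = 1.91618`,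
  `E_ZR/J_P ∈ (7.34, 7.35)`.
* §5 the FOURTH-ORDER nearest-neighbour superexchange in its PRIMARY normalisation
  [MullerHartmannReischl2002, p. 6: «`J^(4) = 2t_pd⁴/Δ²·(4/(2Δ) + 2/U) = 4t_pd⁴(U + Δ)/(UΔ³)`»,
  `U_p = 0`, citing Zaanen], extended with `U_p` as `4t_pd⁴/Δ²·(1/U_d + 2/(2Δ + U_p))` (the venture
  kernel `Summit.….Downfold.EmeryCell.J4` has the same form), and the RECORD that the textbook's
  eq. (2.25), `t_pd⁴/Δ²(1/U_d + 1/Δ)`, is exactly ONE QUARTER of it (`J4_eq_four_mul_textbook`) — a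
  disagreement between sources reported, not adjudicated here beyond the exact-diagonalisation check
  recorded in the cell (REFVALS-1 ⚑ #5).

* §6 (2.17) ON THE `L × L` TORUS (Born–von Kármán grid, the tree's torus characters `χ_k`): with
  `p = 2πk/L`, `u_k² = 4χ_k(0) + χ_k(e_x) + χ_k(−e_x) + χ_k(e_y) + χ_k(−e_y)` (`L ≥ 2`), hence the
  lattice Fourier coefficient `t_W[u²](R) = 4·𝟙[R = 0] + Σ_{e ∈ {±e_x, ±e_y}} 𝟙[R = e]` (any `L ≥ 2`;
  on `L ≥ 3` the five sites are distinct: `4 / 1 / 0`), and the REAL-SPACE form as printed: with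
  `u(r) = (2/N) Σ_k √(c_x² + c_y²) χ_k(r)`, `Σ_i u(i−j) u(i−j′) = t_W[u²](j − j′)` (the finite-Fourier
  convolution identity, written out) `= 4 / 1 / 0` for `j = j′` / nearest neighbours / otherwise.

Everything PROVED or a definition with its printed body; 0 facts; no `sorry`.  NOT here: the
numbers `u(0,0), u(1,0), u(1,1)` as theorems (Brillouin-zone integrals), the projection
`P_ZR a P_ZR = −σ d† e/√2` (2.32), any statement that these leading-order forms give VALUES for a
cuprate (they do not: cluster ED differs by ≈ 2 at `t_pd/Δ ≈ 0.35–0.5`).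

References: T. Xiang, C. Wu, *D-wave Superconductivity* (CUP 2022), §2.4–2.5, Eqs. (2.13)–(2.34)
(held text p0063–p0066); E. Müller-Hartmann, A. Reischl, Eur. Phys. J. B 28 (2002) 173,
arXiv:cond-mat/0105392, p. 6; F. C. Zhang, T. M. Rice, Phys. Rev. B 37 (1988) 3759.  AI-produced
formalisation (H21, cell hubbard-downfold, seat lit-1, 2026-08-27).
-/

noncomputable section

namespace Literature.MathematicalPhysics.QuantumLattice

namespace ZhangRice

open Real Matrix

/-! ## 1. The plaquette rotation at fixed momentum -/

/-- `c_x = cos(k_x/2)`. [cite: XiangWu2022, Eq. (2.16)] -/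
def cx (kx : ℝ) : ℝ := cos (kx / 2)

/-- `c_y = cos(k_y/2)`. [cite: XiangWu2022, Eq. (2.16)] -/
def cy (ky : ℝ) : ℝ := cos (ky / 2)

/-- The normalisation `N_k = √(c_x² + c_y²)` (`u_k = 2N_k`). [cite: XiangWu2022, Eq. (2.14)] -/
def nrm (cx cy : ℝ) : ℝ := √(cx ^ 2 + cy ^ 2)

/-- `N_k² = c_x² + c_y²`. [cite: XiangWu2022, Eq. (2.14)] -/
theorem nrm_sq (cx cy : ℝ) : nrm cx cy ^ 2 = cx ^ 2 + cy ^ 2 := Real.sq_sqrt (by positivity)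

/-- `N_k ≠ 0` away from `c_x = c_y = 0`. [cite: XiangWu2022, Eq. (2.14)] -/
theorem nrm_ne_zero {cx cy : ℝ} (h : cx ^ 2 + cy ^ 2 ≠ 0) : nrm cx cy ≠ 0 := by
  intro h0
  have := nrm_sq cx cy
  rw [h0] at this
  exact h (by simpa using this.symm)

/-- The plaquette rotation `R = (1/N)[[c_x, c_y], [c_y, −c_x]]` taking `(p_x, p_y)` to `(a, b)`.
[cite: XiangWu2022, Eqs. (2.14)–(2.15)] -/
def rot (cx cy : ℝ) : Matrix (Fin 2) (Fin 2) ℝ :=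
  (nrm cx cy)⁻¹ • !![cx, cy; cy, -cx]

/-- `R` is symmetric. [cite: XiangWu2022, Eqs. (2.14)–(2.15)] -/
theorem rot_transpose (cx cy : ℝ) : (rot cx cy)ᵀ = rot cx cy := by
  ext i j; fin_cases i <;> fin_cases j <;> simp [rot]

/-- `R² = 1` (so `Rᵀ R = 1`: the rotation is orthogonal and `(a, b)` are canonical fermions), for
`c_x² + c_y² ≠ 0`. [cite: XiangWu2022, Eqs. (2.14)–(2.15)] -/
theorem rot_mul_rot {cx cy : ℝ} (h : cx ^ 2 + cy ^ 2 ≠ 0) : rot cx cy * rot cx cy = 1 := by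
  have hn := nrm_ne_zero h
  have hsq := nrm_sq cx cy
  ext i j
  fin_cases i <;> fin_cases j <;>
    simp [rot, Matrix.mul_apply, Fin.sum_univ_two] <;>
    field_simp <;> nlinarith [hsq]

/-- `Rᵀ R = 1`. [cite: XiangWu2022, Eqs. (2.14)–(2.15)] -/
theorem rot_transpose_mul_rot {cx cy : ℝ} (h : cx ^ 2 + cy ^ 2 ≠ 0) :
    (rot cx cy)ᵀ * rot cx cy = 1 := by
  rw [rot_transpose, rot_mul_rot h]

/-- `det R = −1`: a reflection. [cite: XiangWu2022, Eqs. (2.14)–(2.15)] -/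
theorem det_rot {cx cy : ℝ} (h : cx ^ 2 + cy ^ 2 ≠ 0) : (rot cx cy).det = -1 := by
  have hn := nrm_ne_zero h
  have hsq := nrm_sq cx cy
  rw [rot, Matrix.det_smul, Matrix.det_fin_two_of, Fintype.card_fin]
  field_simp
  nlinarith [hsq]

/-! ## 2. `d` couples to `a` only; `b` decouples -/

/-- The `d`–`(p_x, p_y)` hybridisation row at momentum `k` in the uniform-sign gauge of the source:
`−t_pd (2c_x, 2c_y)` (from `Σ_± e^{±ik_x/2} = 2cos(k_x/2)`). [cite: XiangWu2022, Eq. (2.13)] -/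
def hyb (tpd cx cy : ℝ) : Fin 2 → ℝ := ![-tpd * (2 * cx), -tpd * (2 * cy)]

/-- The form factor `u_k = 2√(c_x² + c_y²)`. [cite: XiangWu2022, Eq. (2.16)] -/
def u (cx cy : ℝ) : ℝ := 2 * nrm cx cy

/-- **Two-band reduction**: in the rotated basis the hybridisation row is `(−t_pd u_k, 0)` — `d` couples
to `a` with `−t_pd u_k` and NOT to `b` («`b_i` is a nonbonding orbital»). [cite: XiangWu2022, Eq. (2.13)] -/
theorem rot_mulVec_hyb {cx cy : ℝ} (h : cx ^ 2 + cy ^ 2 ≠ 0) (tpd : ℝ) :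
    rot cx cy *ᵥ hyb tpd cx cy = ![-tpd * u cx cy, 0] := by
  have hn := nrm_ne_zero h
  have hsq := nrm_sq cx cy
  ext i
  fin_cases i
  · simp [rot, hyb, u, Matrix.mulVec, dotProduct, Fin.sum_univ_two]
    field_simp
    linear_combination tpd * hsq
  · simp [rot, hyb, Matrix.mulVec, dotProduct, Fin.sum_univ_two]
    ring

/-- The squared coupling is basis independent: `|hyb|² = t_pd² u_k²`. [cite: XiangWu2022, Eq. (2.16)] -/
theorem hyb_dotProduct_self (tpd cx cy : ℝ) :
    hyb tpd cx cy ⬝ᵥ hyb tpd cx cy = tpd ^ 2 * u cx cy ^ 2 := by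
  have hsq := nrm_sq cx cy
  simp [hyb, u]
  nlinarith [hsq]

/-! ## 3. `u_k²` is a nearest-neighbour trigonometric polynomial -/

/-- **`u_k² = 4 + 2cos k_x + 2cos k_y`** (`= 4(cos²(k_x/2) + cos²(k_y/2))`, half-angle identity): the
Fourier side of «`Σ_i u(i−j)u(i−j′) = 4δ_{j,j′} + δ_{⟨j,j′⟩}`» — coefficient `4` at `R = 0`, `1` on each
of the four nearest-neighbour bonds. [cite: XiangWu2022, Eq. (2.17)] -/
theorem u_sq (kx ky : ℝ) : u (cx kx) (cy ky) ^ 2 = 4 + 2 * cos kx + 2 * cos ky := by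
  rw [u, mul_pow, nrm_sq, cx, cy]
  have hx : cos kx = 2 * cos (kx / 2) ^ 2 - 1 := by rw [← cos_two_mul]; ring_nf
  have hy : cos ky = 2 * cos (ky / 2) ^ 2 - 1 := by rw [← cos_two_mul]; ring_nf
  rw [hx, hy]; ring

/-- `0 ≤ u_k² ≤ 8`. [cite: XiangWu2022, Eq. (2.17)] -/
theorem u_sq_mem_Icc (kx ky : ℝ) : u (cx kx) (cy ky) ^ 2 ∈ Set.Icc (0 : ℝ) 8 := by
  rw [u_sq, Set.mem_Icc]
  have h1 := abs_le.mp (abs_cos_le_one kx)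
  have h2 := abs_le.mp (abs_cos_le_one ky)
  constructor <;> linarith [h1.1, h1.2, h2.1, h2.2]

/-- At `Γ` the coupling is maximal: `u_0² = 8`. [cite: XiangWu2022, Eq. (2.17)] -/
theorem u_sq_gamma : u (cx 0) (cy 0) ^ 2 = 8 := by
  rw [u_sq, cos_zero]; norm_num

/-- `u_k² = 0` exactly where `cos k_x = cos k_y = −1` (the zone corner `(π, π)` mod `2π`).
[cite: XiangWu2022, Eq. (2.17)] -/
theorem u_sq_eq_zero_iff (kx ky : ℝ) :
    u (cx kx) (cy ky) ^ 2 = 0 ↔ cos kx = -1 ∧ cos ky = -1 := by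
  rw [u_sq]
  have h1 := abs_le.mp (abs_cos_le_one kx)
  have h2 := abs_le.mp (abs_cos_le_one ky)
  constructor
  · intro h; constructor <;> linarith [h1.1, h2.1]
  · rintro ⟨hx, hy⟩; rw [hx, hy]; norm_num

/-- At `M = (π, π)` the rotation is undefined (`c_x = c_y = 0`) and `u = 0`. [cite: XiangWu2022, Eq. (2.17)] -/
theorem u_sq_M : u (cx π) (cy π) ^ 2 = 0 := by
  rw [u_sq_eq_zero_iff, cos_pi]; exact ⟨rfl, rfl⟩

/-! ## 4. The second-order scales and the Zhang–Rice splitting (printed forms) -/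

/-- `t_P = t_pd²/Δ` (`Δ = ε_p − ε_d > 0`). [cite: XiangWu2022, Eq. (2.21)] -/
def tP (tpd Δ : ℝ) : ℝ := tpd ^ 2 / Δ

/-- `J_P = t_pd²/Δ + t_pd²/(U_d − Δ)`. [cite: XiangWu2022, Eq. (2.22)] -/
def JP (tpd Δ Ud : ℝ) : ℝ := tpd ^ 2 / Δ + tpd ^ 2 / (Ud - Δ)

/-- The Zhang–Rice singlet–triplet splitting `E_ZR = 2J_P u(0)²` (with the on-site truncation
`u(r) ≈ u(0)δ_{r,0}`). [cite: XiangWu2022, Eq. (2.29)] -/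
def EZR (JP u0 : ℝ) : ℝ := 2 * JP * u0 ^ 2

/-- The one-band nearest-neighbour hopping of the projected model, `t = t_P/2`. [cite: XiangWu2022, Eq. (2.34)] -/
def tOneBand (tpd Δ : ℝ) : ℝ := tP tpd Δ / 2

/-- The printed `u(0,0) = 1.91618` (= twice Zhang–Rice's `0.958`). [cite: XiangWu2022, Eq. (2.17)] -/
def u00 : ℝ := 1.91618

/-- `J_P = t_P · U_d/(U_d − Δ)` (exact algebra; `Δ ≠ 0`, `U_d ≠ Δ`). [cite: XiangWu2022, Eq. (2.22)] -/
theorem JP_eq (tpd : ℝ) {Δ Ud : ℝ} (hΔ : Δ ≠ 0) (hU : Ud - Δ ≠ 0) :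
    JP tpd Δ Ud = tP tpd Δ * (Ud / (Ud - Δ)) := by
  rw [JP, tP]; field_simp; ring

/-- In the charge-transfer regime `U_d > Δ > 0` (and `t_pd ≠ 0`): `0 < t_P < J_P`. [cite: XiangWu2022, Eq. (2.6)] -/
theorem tP_pos_lt_JP {tpd Δ Ud : ℝ} (ht : tpd ≠ 0) (hΔ : 0 < Δ) (hU : Δ < Ud) :
    0 < tP tpd Δ ∧ tP tpd Δ < JP tpd Δ Ud := by
  have h2 : 0 < tpd ^ 2 := by positivity
  refine ⟨div_pos h2 hΔ, ?_⟩
  rw [JP, tP]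
  have : 0 < tpd ^ 2 / (Ud - Δ) := div_pos h2 (by linarith)
  linarith

/-- `E_ZR / J_P = 2u(0)²`; at the printed `u(0) = 1.91618` this ratio lies in `(7.34, 7.35)`.
[cite: XiangWu2022, Eq. (2.29)] -/
theorem EZR_ratio {J : ℝ} (hJ : J ≠ 0) :
    EZR J u00 / J = 2 * u00 ^ 2 ∧ (7.34 : ℝ) < 2 * u00 ^ 2 ∧ 2 * u00 ^ 2 < 7.35 := by
  refine ⟨by rw [EZR]; field_simp, ?_, ?_⟩ <;> simp only [u00] <;> norm_num

/-- `u(0) = 2 × 0.95809`: the printed `1.91618` is twice Zhang–Rice's overlap `0.958`. [cite: XiangWu2022, Eq. (2.17)] -/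
theorem u00_half : u00 / 2 = 0.95809 := by simp only [u00]; norm_num

/-! ## 5. The fourth-order superexchange: primary normalisation and the textbook's coefficient -/

/-- The fourth-order nearest-neighbour superexchange of the three-band model,
`J⁽⁴⁾ = 4t_pd⁴/Δ²·(1/U_d + 2/(2Δ + U_p))` (both the Cu double-occupancy and the two-holes-on-oxygen
channels; printed at `U_p = 0` as «`2t_pd⁴/Δ²(4/(2Δ) + 2/U)`»). Venture twin:
`Summit.Ventures.CertifiedManyBodySolver.Downfold.EmeryCell.J4`. [cite: MullerHartmannReischl2002, p. 6] -/
def J4 (tpd Δ Ud Up : ℝ) : ℝ := 4 * tpd ^ 4 / Δ ^ 2 * (1 / Ud + 2 / (2 * Δ + Up))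

/-- The printed closed form at `U_p = 0`: `J⁽⁴⁾ = 2t_pd⁴/Δ²(4/(2Δ) + 2/U) = 4t_pd⁴(U + Δ)/(UΔ³)`.
[cite: MullerHartmannReischl2002, p. 6] -/
theorem J4_zero_Up (tpd : ℝ) {Δ Ud : ℝ} (hΔ : Δ ≠ 0) (hU : Ud ≠ 0) :
    J4 tpd Δ Ud 0 = 2 * tpd ^ 4 / Δ ^ 2 * (4 / (2 * Δ) + 2 / Ud) ∧
      J4 tpd Δ Ud 0 = 4 * tpd ^ 4 * (Ud + Δ) / (Ud * Δ ^ 3) := by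
  constructor
  · rw [J4, add_zero]; field_simp; ring
  · rw [J4, add_zero]; field_simp; ring

/-- The `U_d`-channel alone is the one-band dictionary value with the second-order hopping:
`4t_pd⁴/(Δ²U_d) = 4 t_P²/U_d`. [cite: MullerHartmannReischl2002, p. 6] -/
theorem J4_Ud_channel (tpd : ℝ) {Δ : ℝ} (hΔ : Δ ≠ 0) (Ud : ℝ) :
    4 * tpd ^ 4 / Δ ^ 2 * (1 / Ud) = 4 * tP tpd Δ ^ 2 / Ud := by
  rw [tP]; field_simp

/-- The textbook coefficient as printed, `t_pd⁴/Δ²(1/U_d + 1/Δ)`. [cite: XiangWu2022, Eq. (2.25)] -/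
def textbookJ (tpd Δ Ud : ℝ) : ℝ := tpd ^ 4 / Δ ^ 2 * (1 / Ud + 1 / Δ)

/-- **Disagreement between sources, exact**: at `U_p = 0` the primary fourth-order coefficient is FOUR
times the textbook's eq. (2.25). [cite: MullerHartmannReischl2002, p. 6] -/
theorem J4_eq_four_mul_textbook (tpd : ℝ) {Δ Ud : ℝ} (hΔ : Δ ≠ 0) (hU : Ud ≠ 0) :
    J4 tpd Δ Ud 0 = 4 * textbookJ tpd Δ Ud := by
  rw [J4, textbookJ, add_zero]
  field_simp

/-- `J⁽⁴⁾` decreases with `U_p` (the oxygen channel closes): for `0 ≤ U_p ≤ U_p'` (positive `Δ`,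
any `U_d`), `J4 … U_p' ≤ J4 … U_p`. [cite: MullerHartmannReischl2002, p. 6] -/
theorem J4_antitone_Up (tpd : ℝ) {Δ Up Up' : ℝ} (Ud : ℝ) (hΔ : 0 < Δ) (h0 : 0 ≤ Up)
    (hle : Up ≤ Up') : J4 tpd Δ Ud Up' ≤ J4 tpd Δ Ud Up := by
  unfold J4
  have hc : 0 ≤ 4 * tpd ^ 4 / Δ ^ 2 := by positivity
  apply mul_le_mul_of_nonneg_left _ hc
  have h1 : 0 < 2 * Δ + Up := by linarith
  have h2 : 0 < 2 * Δ + Up' := by linarith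
  have : 2 / (2 * Δ + Up') ≤ 2 / (2 * Δ + Up) := div_le_div_of_nonneg_left (by norm_num) h1 (by linarith)
  linarith

/-! ## 6. (2.17) on the `L × L` torus: Fourier side and the real-space convolution as printed -/

section Torus

open Finset Literature.Probability.LatticeModels TBFit
open scoped ComplexConjugate

variable {L : ℕ} [NeZero L]

/-- The unit step `e_x` of the `L × L` torus `(ℤ/Lℤ)²`. [folklore] -/
def ex : TorusSite 2 L := Pi.single 0 1

/-- The unit step `e_y` of the `L × L` torus. [folklore] -/
def ey : TorusSite 2 L := Pi.single 1 1

/-- The lattice momentum components `p_i = 2πk_i/L` of a torus momentum `k`. [folklore] -/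
def pT (k : TorusSite 2 L) (i : Fin 2) : ℝ := latticeMomentum L k i

/-- `u_k² = 4(c_x² + c_y²)` evaluated at the torus momentum `p = 2πk/L`, as a complex number (the
Fourier side of (2.17) restricted to the `L × L` Born–von Kármán grid). [cite: XiangWu2022, Eq. (2.16)-(2.17)] -/
def uSqT (k : TorusSite 2 L) : ℂ := ((u (cx (pT k 0)) (cy (pT k 1)) ^ 2 : ℝ) : ℂ)

/-- `χ_k(e_i) = e^{i p_i}` (`L ≥ 2`; plumbing, cf. the tree's `torusChar_single`). [folklore] -/
private theorem torusChar_single_eq_exp_pT (hL : 2 ≤ L) (k : TorusSite 2 L) (i : Fin 2) :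
    torusChar k (Pi.single i 1) = Complex.exp ((pT k i : ℝ) * Complex.I) := by
  unfold torusChar
  rw [Finset.prod_eq_single i (fun j _ hj => by
      rw [Pi.single_eq_of_ne hj, mul_zero, AddChar.map_zero_eq_one])
    (fun h => absurd (Finset.mem_univ i) h), Pi.single_eq_same, stdAddChar_mul_eq_exp]
  congr 1
  rw [ZMod.val_one'' (by omega), mul_one]
  simp only [pT, latticeMomentum]
  push_cast
  ring

/-- `χ_k(e_i) + χ_k(−e_i) = 2cos p_i` (`L ≥ 2`). [cite: FriedliVelenik2017, §10.4] -/
theorem torusChar_single_add_neg (hL : 2 ≤ L) (k : TorusSite 2 L) (i : Fin 2) :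
    torusChar k (Pi.single i 1) + torusChar k (-Pi.single i 1) =
      ((2 * Real.cos (pT k i) : ℝ) : ℂ) := by
  rw [torusChar_neg_right, torusChar_single_eq_exp_pT hL, Complex.add_conj,
    Complex.exp_ofReal_mul_I_re]

/-- `χ_{−k}(x) = χ_k(−x)` (plumbing). [folklore] -/
private theorem torusChar_neg_left_eq (k x : TorusSite 2 L) : torusChar (-k) x = torusChar k (-x) := by
  rw [torusChar_comm, torusChar_neg_right, torusChar_comm, ← torusChar_neg_right]

/-- `cos p_i(−k) = cos p_i(k)` (the momentum of `−k` is `2π − p` or `0`; via characters; cf. the tree's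
`cos_latticeMomentum_neg`). [cite: FriedliVelenik2017, §10.4] -/
theorem cos_pT_neg (hL : 2 ≤ L) (k : TorusSite 2 L) (i : Fin 2) :
    Real.cos (pT (-k) i) = Real.cos (pT k i) := by
  have h := torusChar_single_add_neg hL (-k) i
  rw [torusChar_neg_left_eq, torusChar_neg_left_eq, neg_neg, add_comm, torusChar_single_add_neg hL] at h
  have h' := Complex.ofReal_injective h
  linarith

/-- **`u_k²` IS THE NEAREST-NEIGHBOUR CHARACTER POLYNOMIAL on the torus**:
`u_k² = 4χ_k(0) + χ_k(e_x) + χ_k(−e_x) + χ_k(e_y) + χ_k(−e_y)` (`L ≥ 2`).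
[cite: XiangWu2022, Eq. (2.17)] -/
theorem uSqT_eq (hL : 2 ≤ L) (k : TorusSite 2 L) :
    uSqT k = 4 * torusChar k 0 + torusChar k ex + torusChar k (-ex) + torusChar k ey +
      torusChar k (-ey) := by
  have hx : torusChar k ex + torusChar k (-ex) = ((2 * Real.cos (pT k 0) : ℝ) : ℂ) :=
    torusChar_single_add_neg hL k 0
  have hy : torusChar k ey + torusChar k (-ey) = ((2 * Real.cos (pT k 1) : ℝ) : ℂ) :=
    torusChar_single_add_neg hL k 1
  calc uSqT k = 4 + ((2 * Real.cos (pT k 0) : ℝ) : ℂ) + ((2 * Real.cos (pT k 1) : ℝ) : ℂ) := by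
        rw [uSqT, u_sq]; push_cast; ring
    _ = _ := by rw [← hx, ← hy, torusChar_zero_right]; ring

/-- Orthogonality in the index order used by `TBFit.fourierHopping`:
`Σ_k χ_k(a) conj χ_R(k) = L² [R = a]`. [folklore] -/
private theorem sum_torusChar_mul_conj_fh (a R : TorusSite 2 L) :
    ∑ k : TorusSite 2 L, torusChar k a * conj (torusChar R k) = if R = a then (L : ℂ) ^ 2 else 0 := by
  have h := TorusBlock.sum_torusChar_mul_conj a R
  simp_rw [torusChar_comm a] at h
  rw [h]
  by_cases haR : a = R
  · rw [if_pos haR, if_pos haR.symm]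
  · rw [if_neg haR, if_neg (Ne.symm haR)]

/-- **(2.17) IN FOURIER-INVERTED FORM on the `L × L` torus (`L ≥ 2`)**: the lattice Fourier
coefficients of `u_k²` are `4` at `R = 0` plus `1` for each of the four unit steps `±e_x, ±e_y` that
equals `R` (on `L ≥ 3` these are five distinct sites, `fourierHopping_uSqT_of_three_le`; on `L = 2`
the steps `e` and `−e` coincide and the coefficient there is `2` — aliasing, stated honestly by the sum
of indicators). [cite: XiangWu2022, Eq. (2.17)] -/
theorem fourierHopping_uSqT (hL : 2 ≤ L) (R : TorusSite 2 L) :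
    fourierHopping uSqT R = (if R = 0 then 4 else 0) + (if R = ex then 1 else 0) +
      (if R = -ex then 1 else 0) + (if R = ey then 1 else 0) + (if R = -ey then 1 else 0) := by
  have hL0 : ((L : ℂ) ^ 2) ≠ 0 := pow_ne_zero 2 (Nat.cast_ne_zero.mpr (NeZero.ne L))
  rw [fourierHopping_eq]
  have hsum : ∑ k : TorusSite 2 L, uSqT k * conj (torusChar R k) =
      4 * (if R = 0 then (L : ℂ) ^ 2 else 0) + (if R = ex then (L : ℂ) ^ 2 else 0) +
      (if R = -ex then (L : ℂ) ^ 2 else 0) + (if R = ey then (L : ℂ) ^ 2 else 0) +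
      (if R = -ey then (L : ℂ) ^ 2 else 0) := by
    simp_rw [uSqT_eq hL, add_mul, Finset.sum_add_distrib, mul_assoc, ← Finset.mul_sum,
      sum_torusChar_mul_conj_fh]
  rw [hsum, div_eq_iff hL0]
  split_ifs <;> ring

omit [NeZero L] in
/-- On `L ≥ 2`: `(1 : ℤ/Lℤ) ≠ 0`. [folklore] -/
private theorem one_ne_zero_zmod (hL : 2 ≤ L) : (1 : ZMod L) ≠ 0 := by
  haveI : NeZero L := ⟨by omega⟩
  intro h
  have := congrArg ZMod.val h
  rw [ZMod.val_one'' (by omega), ZMod.val_zero] at this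
  exact one_ne_zero this

omit [NeZero L] in
/-- On `L ≥ 3`: `(1 : ℤ/Lℤ) ≠ −1`. [folklore] -/
private theorem one_ne_neg_one_zmod (hL : 3 ≤ L) : (1 : ZMod L) ≠ -1 := by
  intro h
  have h2 : ((2 : ℕ) : ZMod L) = 0 := by
    have : (2 : ZMod L) = 0 := by linear_combination h
    exact_mod_cast this
  rw [ZMod.natCast_eq_zero_iff] at h2
  exact absurd (Nat.le_of_dvd (by norm_num) h2) (by omega)

omit [NeZero L] in
/-- Pairwise distinctness of `0, ±e_x, ±e_y` on the `L × L` torus for `L ≥ 3`. [folklore] -/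
private theorem steps_distinct (hL : 3 ≤ L) :
    (ex : TorusSite 2 L) ≠ 0 ∧ (-ex : TorusSite 2 L) ≠ 0 ∧ (ey : TorusSite 2 L) ≠ 0 ∧
    (-ey : TorusSite 2 L) ≠ 0 ∧ (ex : TorusSite 2 L) ≠ -ex ∧ (ex : TorusSite 2 L) ≠ ey ∧
    (ex : TorusSite 2 L) ≠ -ey ∧ (-ex : TorusSite 2 L) ≠ ey ∧ (-ex : TorusSite 2 L) ≠ -ey ∧
    (ey : TorusSite 2 L) ≠ -ey := by
  have h1 := one_ne_zero_zmod (L := L) (by omega)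
  have h2 := one_ne_neg_one_zmod hL
  have h10 : (1 : Fin 2) ≠ 0 := by decide
  have h01 : (0 : Fin 2) ≠ 1 := by decide
  refine ⟨?_, ?_, ?_, ?_, ?_, ?_, ?_, ?_, ?_, ?_⟩
  · intro h; exact h1 (by simpa [ex] using congr_fun h 0)
  · intro h; exact h1 (by simpa [ex] using congr_fun h 0)
  · intro h; exact h1 (by simpa [ey] using congr_fun h 1)
  · intro h; exact h1 (by simpa [ey] using congr_fun h 1)
  · intro h; exact h2 (by simpa [ex] using congr_fun h 0)
  · intro h; exact h1 (by simpa [ex, ey, h01] using congr_fun h 0)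
  · intro h; exact h1 (by simpa [ex, ey, h01] using congr_fun h 0)
  · intro h; exact h1 (by simpa [ex, ey, h01] using congr_fun h 0)
  · intro h; exact h1 (by simpa [ex, ey, h01] using congr_fun h 0)
  · intro h; exact h2 (by simpa [ey] using congr_fun h 1)

/-- **(2.17), Fourier-inverted, on `L ≥ 3`**: the lattice Fourier coefficient of `u_k²` is `4` at
`R = 0`, `1` on each of the four nearest-neighbour steps, `0` elsewhere. [cite: XiangWu2022, Eq. (2.17)] -/
theorem fourierHopping_uSqT_of_three_le (hL : 3 ≤ L) (R : TorusSite 2 L) :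
    fourierHopping uSqT R =
      if R = 0 then 4 else if R = ex ∨ R = -ex ∨ R = ey ∨ R = -ey then 1 else 0 := by
  rw [fourierHopping_uSqT (by omega) R]
  obtain ⟨h1, h2, h3, h4, h5, h6, h7, h8, h9, h10⟩ := steps_distinct hL
  by_cases ha : R = 0
  · subst ha; simp [h1.symm, h2.symm, h3.symm, h4.symm]
  by_cases hb : R = ex
  · subst hb; simp [h1, h5, h6, h7]
  by_cases hc : R = -ex
  · subst hc; simp [h2, h5.symm, h8, h9]
  by_cases hd : R = ey
  · subst hd; simp [h3, h6.symm, h8.symm, h10]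
  by_cases he : R = -ey
  · subst he; simp [h4, h7.symm, h9.symm, h10.symm]
  simp [ha, hb, hc, hd, he]

/-! ### The real-space form: `Σ_i u(i−j) u(i−j′) = 4δ_{jj′} + δ_{⟨jj′⟩}` -/

/-- `n_k = √(c_x² + c_y²)` at the torus momentum `p = 2πk/L` (complex-valued). [cite: XiangWu2022, Eq. (2.14)] -/
def nT (k : TorusSite 2 L) : ℂ := (nrm (cx (pT k 0)) (cy (pT k 1)) : ℂ)

/-- The real-space `d`–`a` hybridisation amplitude `u(r) = (2/N) Σ_k √(c_x² + c_y²) e^{ik·r}` on the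
`L × L` torus (`N = L²`). [cite: XiangWu2022, Eq. (2.16)] -/
def uR (R : TorusSite 2 L) : ℂ := 2 / (L : ℂ) ^ 2 * ∑ k : TorusSite 2 L, nT k * torusChar k R

omit [NeZero L] in
/-- `u_k² = 4n_k²`. [cite: XiangWu2022, Eq. (2.16)] -/
theorem uSqT_eq_nT (k : TorusSite 2 L) : uSqT k = 4 * nT k ^ 2 := by
  simp only [uSqT, nT, u]; push_cast; ring

/-- `n_{−k} = n_k` (`L ≥ 2`): the form factor is even in `k`. [cite: XiangWu2022, Eq. (2.14)] -/
theorem nT_neg (hL : 2 ≤ L) (k : TorusSite 2 L) : nT (-k) = nT k := by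
  have h : ∀ x : ℝ, Real.cos (x / 2) ^ 2 = 1 / 2 + Real.cos x / 2 := fun x => by
    have hx : 2 * (x / 2) = x := by ring
    rw [Real.cos_sq, hx]
  simp only [nT, nrm, cx, cy, h, cos_pT_neg hL]

/-- **ZHANG–RICE (2.17) ON THE TORUS, REAL-SPACE FORM = FOURIER COEFFICIENT OF `u_k²`**:
`Σ_i u(i−j) u(i−j′) = t_W[u²](j − j′)` (`L ≥ 2`; the convolution theorem for the finite Fourier
transform, written out). [cite: XiangWu2022, Eq. (2.17)] -/
theorem sum_uR_mul_uR (hL : 2 ≤ L) (j j' : TorusSite 2 L) :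
    ∑ i : TorusSite 2 L, uR (i - j) * uR (i - j') = fourierHopping uSqT (j - j') := by
  have hL0 : ((L : ℂ) ^ 2) ≠ 0 := pow_ne_zero 2 (Nat.cast_ne_zero.mpr (NeZero.ne L))
  -- (1) the `i`-sum of two characters
  have hI : ∀ k k' : TorusSite 2 L, ∑ i : TorusSite 2 L, torusChar k (i - j) * torusChar k' (i - j') =
      conj (torusChar k j) * conj (torusChar k' j') * (if k + k' = 0 then (L : ℂ) ^ 2 else 0) := by
    intro k k'
    have h : ∀ i, torusChar k (i - j) * torusChar k' (i - j') =
        conj (torusChar k j) * conj (torusChar k' j') * torusChar (k + k') i := by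
      intro i; rw [torusChar_sub_right, torusChar_sub_right, torusChar_add_left]; ring
    simp_rw [h, ← Finset.mul_sum, sum_torusChar_right]
  -- (2) each summand of the `i`-sum as a double `k`-sum
  have hP : ∀ i : TorusSite 2 L, uR (i - j) * uR (i - j') = (2 / (L : ℂ) ^ 2) * (2 / (L : ℂ) ^ 2) *
      ∑ k, ∑ k', nT k * nT k' * (torusChar k (i - j) * torusChar k' (i - j')) := by
    intro i
    have : uR (i - j) * uR (i - j') = (2 / (L : ℂ) ^ 2) * (2 / (L : ℂ) ^ 2) *
        ((∑ k, nT k * torusChar k (i - j)) * (∑ k', nT k' * torusChar k' (i - j'))) := by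
      rw [uR, uR]; ring
    rw [this, Finset.sum_mul_sum]
    congr 1
    exact Finset.sum_congr rfl fun k _ => Finset.sum_congr rfl fun k' _ => by ring
  -- (3) the `k'`-sum collapses to `k' = −k`
  have hK : ∀ k : TorusSite 2 L, ∑ i : TorusSite 2 L, ∑ k', nT k * nT k' *
      (torusChar k (i - j) * torusChar k' (i - j')) =
      nT k ^ 2 * (conj (torusChar k j) * torusChar k j') * (L : ℂ) ^ 2 := by
    intro k
    rw [Finset.sum_comm]
    simp_rw [← Finset.mul_sum, hI]
    have h3 : ∀ k' : TorusSite 2 L, nT k * nT k' * (conj (torusChar k j) * conj (torusChar k' j') *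
        (if k + k' = 0 then (L : ℂ) ^ 2 else 0)) =
        if k' = -k then nT k ^ 2 * (conj (torusChar k j) * torusChar k j') * (L : ℂ) ^ 2 else 0 := by
      intro k'
      by_cases h : k' = -k
      · rw [if_pos h, if_pos (by rw [h]; exact add_neg_cancel k), h, nT_neg hL, torusChar_neg_left_eq,
          torusChar_neg_right, Complex.conj_conj]
        ring
      · rw [if_neg h, if_neg (fun h' => h (eq_neg_of_add_eq_zero_right h'))]
        ring
    simp_rw [h3]
    rw [Finset.sum_ite_eq' Finset.univ (-k)]
    simp
  -- (4) assemble the left-hand side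
  have hLHS : ∑ i : TorusSite 2 L, uR (i - j) * uR (i - j') =
      4 / (L : ℂ) ^ 2 * ∑ k, nT k ^ 2 * (conj (torusChar k j) * torusChar k j') := by
    simp_rw [hP]
    rw [← Finset.mul_sum, Finset.sum_comm]
    simp_rw [hK]
    rw [← Finset.sum_mul]
    field_simp
    ring
  -- (5) the right-hand side
  have hRHS : fourierHopping uSqT (j - j') =
      4 / (L : ℂ) ^ 2 * ∑ k, nT k ^ 2 * (conj (torusChar k j) * torusChar k j') := by
    have h : ∀ k : TorusSite 2 L, uSqT k * conj (torusChar (j - j') k) =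
        4 * (nT k ^ 2 * (conj (torusChar k j) * torusChar k j')) := by
      intro k
      rw [torusChar_comm, torusChar_sub_right, map_mul, Complex.conj_conj, uSqT_eq_nT]; ring
    rw [fourierHopping_eq]
    simp_rw [h]
    rw [← Finset.mul_sum]
    field_simp
  rw [hLHS, hRHS]

/-- **ZHANG–RICE (2.17) AS PRINTED, on the `L × L` torus with `L ≥ 3`**:
`Σ_i u(i−j) u(i−j′) = 4` if `j = j′`, `= 1` if `j − j′` is one of the four unit steps, `= 0` otherwise
— the plaquette orbitals `P_j = ½ Σ u(i−j) a_i`-type combinations are NOT orthogonal between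
nearest neighbours (overlap `¼` after the normalisation by `u(0)… = 2`), the origin of the Zhang–Rice
Wannier orthogonalisation. [cite: XiangWu2022, Eq. (2.17)] -/
theorem zhangRice_overlap (hL : 3 ≤ L) (j j' : TorusSite 2 L) :
    ∑ i : TorusSite 2 L, uR (i - j) * uR (i - j') =
      if j = j' then 4 else if j - j' = ex ∨ j - j' = -ex ∨ j - j' = ey ∨ j - j' = -ey then 1 else 0 := by
  rw [sum_uR_mul_uR (by omega), fourierHopping_uSqT_of_three_le hL]
  simp only [sub_eq_zero]

end Torus

end ZhangRice

end Literature.MathematicalPhysics.QuantumLattice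

end
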